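import Summits.BirchSwinnertonDyer.Rank1Residual.F1Sign2.SignedSpanDefectAtTwo
import Summits.BirchSwinnertonDyer.Rank1Residual.F1Sign2.SignedSubgroupsAtTwoKernel
import HarnessLib

/-!
# Kernel sibling of `SignedSpanDefectAtTwo.lean` (cell `bsd-f1-sign2`, D-imc-60 house-style port; typer -ty g20)

THEOREMS ONLY, all proved (tree lemmas, `decide`); no `def`, no `sorry`, no instance, no named fact.  Typer glue over the house-style carriers (`v.adicCompletion ℚ` at
`v ∋ 2`):
* **`floorLaw_of_injects_of_topDefect : SignedDefectInjectsAtTwo → SignedTopDefectAtTwo → SignedSpanIndexFloorLawAtTwo`** — -imc's «C5 ∧ C6 ⟹ C1′ by induction on n»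
  PROVED by subgroup-index bookkeeping (`AddSubgroup.relIndex_mul_relIndex`, `relIndex_sup_left`, `inf_relIndex_right` = second isomorphism theorem; C5 at `m = n ≤ n+1`;
  base `signedLocalPointsOfEmb_zero`); REF2 v57 §3.2 «C1′ as the corollary of C6 and C5» made a kernel fact;
* `span_eq_layer_of_signedDecomposition` — the `a₂ = 0` span `E⁺_n ⊔ E⁻_n = E(ℚ_{2,n})` in lattice form FROM the cell's filed `F1Sign2.SignedDecompositionAtTwo` (D-imc-47),
  i.e. Sketch61's C2 (`SignedSubgroupsAtTwo.SignedSpanAtTwoOfTraceZero`, the typer's duplicate over `ℚ_[2]`) is (C3-47) read through `AddSubgroup.mem_sup` — the dedup of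
  -imc add3 / REF2's erratum as a theorem;
* `spanIndex_of_rows` — `SignedDecompositionAtTwo ∧ C5 ∧ C6` give the span index at every layer and every good supersingular type: `1` (`a₂ = 0`) / `2^(Σ_{m≤n}⌊2^m/15⌋)`
  (`a₂ = ±2`); `meet_eq_layer_zero_of_rows` — `SignedDecompositionAtTwo ∧ C3±` give `E⁺_n ⊓ E⁻_n = E(ℚ₂)` for all three types;
* `floorLaw_span_of_le_three` — ℕ-division: C1′ asserts the full span at `n ≤ 3` (REF1 §228b BC7-l; census 0,0,0), via the landed
  `SignedSubgroupsAtTwo.Kernel.floorExponent_eq_zero_of_le_three` (p737784; imported, not restated).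
REF1 audit of Sketch63: §228b/§230.  Nothing here bears on BSD; 23715 not closed.  [cite: Kobayashi2003, Def. 1.1, Prop. 8.12] [cite: Sprung2012, Thm. 2.2]
-/

namespace Summit.BirchSwinnertonDyer.Rank1Residual.F1Sign2.SignedSpanDefect.Kernel

open scoped NumberField
open WeierstrassCurve Literature.NumberTheory.EllipticCurves Literature.NumberTheory.EllipticCurves.Rank1Residual
  Literature.NumberTheory.EllipticCurves.Kobayashi2003 ZpExtension NumberField IsDedekindDomain
  Summit.BirchSwinnertonDyer.Rank1Residual.F1Sign2 Summit.BirchSwinnertonDyer.Rank1Residual.F1Sign2.SignedSpanDefect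

/-- **C5 ∧ C6 ⟹ C1′** over the house-style carriers (-imc Sketch62/63: «C5 ∧ C6 ⟹ C1′ by induction on n» — PROVED; pure subgroup-index bookkeeping,
carrier-agnostic): with `S_n = E⁺_n + E⁻_n`, `[E_{n+1} : S_{n+1}] = [E_{n+1} : S_{n+1} + E_n] · [S_{n+1} + E_n : S_{n+1}]` and
`[S_{n+1} + E_n : S_{n+1}] = [E_n : S_{n+1} ∩ E_n] = [E_n : S_n]` (second isomorphism theorem, then C5 at `m = n ≤ n+1`); base `n = 0`: `E^ε_0 = E(k_0)`. -/
theorem floorLaw_of_injects_of_topDefect (h5 : SignedDefectInjectsAtTwo) (h6 : SignedTopDefectAtTwo) :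
    SignedSpanIndexFloorLawAtTwo := by
  intro W _ _ hss ha κ hκ v hv n
  induction n with
  | zero =>
    rw [show signedLocalPoints κ (v.adicCompletion ℚ) W 1 0 = localLayerPoints κ (v.adicCompletion ℚ) W 0 from
        signedLocalPointsOfEmb_zero _ _ W 1,
      show signedLocalPoints κ (v.adicCompletion ℚ) W (-1) 0 = localLayerPoints κ (v.adicCompletion ℚ) W 0 from
        signedLocalPointsOfEmb_zero _ _ W (-1),
      sup_idem, AddSubgroup.relIndex_self]
    decide
  | succ n ih =>
    have hSle : signedLocalPoints κ (v.adicCompletion ℚ) W 1 (n + 1) ⊔ signedLocalPoints κ (v.adicCompletion ℚ) W (-1) (n + 1) ≤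
        localLayerPoints κ (v.adicCompletion ℚ) W (n + 1) :=
      sup_le (signedLocalPointsOfEmb_le _ _ W 1 (n + 1)) (signedLocalPointsOfEmb_le _ _ W (-1) (n + 1))
    have hEn : localLayerPoints κ (v.adicCompletion ℚ) W n ≤ localLayerPoints κ (v.adicCompletion ℚ) W (n + 1) :=
      localLayerPointsOfEmb_mono _ _ W (Nat.le_succ n)
    have hmul := AddSubgroup.relIndex_mul_relIndex
      (signedLocalPoints κ (v.adicCompletion ℚ) W 1 (n + 1) ⊔ signedLocalPoints κ (v.adicCompletion ℚ) W (-1) (n + 1))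
      ((signedLocalPoints κ (v.adicCompletion ℚ) W 1 (n + 1) ⊔ signedLocalPoints κ (v.adicCompletion ℚ) W (-1) (n + 1)) ⊔
        localLayerPoints κ (v.adicCompletion ℚ) W n)
      (localLayerPoints κ (v.adicCompletion ℚ) W (n + 1)) le_sup_left (sup_le hSle hEn)
    rw [← hmul, AddSubgroup.relIndex_sup_left, ← AddSubgroup.inf_relIndex_right, h5 W hss κ hκ v hv n (n + 1) (Nat.le_succ n),
      ih, h6 W hss ha κ hκ v hv n, ← pow_add, Finset.sum_range_succ (fun m => 2 ^ m / 15) (n + 1)]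

/-- The `a₂ = 0` span is the cell's filed `F1Sign2.SignedDecompositionAtTwo` (D-imc-47; its first clause, the `∃ P₁ P₂` decomposition, in lattice form):
`E⁺_n ⊔ E⁻_n = E(ℚ_{2,n})`, hence span index `1` — the dedup of Sketch61's C2 made a kernel fact. -/
theorem span_eq_layer_of_signedDecomposition (h : SignedDecompositionAtTwo) (W : WeierstrassCurve ℚ) [W.IsElliptic] [W.IsGloballyMinimal]
    (hss : GoodSS W 2) (ha : W.frobeniusTrace 2 = 0) (κ : ZpExtension ℚ 2) (hκ : κ.IsCyclotomic)
    (v : HeightOneSpectrum (𝓞 ℚ)) (hv : (2 : 𝓞 ℚ) ∈ v.asIdeal) (n : ℕ) :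
    signedLocalPoints κ (v.adicCompletion ℚ) W 1 n ⊔ signedLocalPoints κ (v.adicCompletion ℚ) W (-1) n =
      localLayerPoints κ (v.adicCompletion ℚ) W n := by
  refine le_antisymm (sup_le (signedLocalPointsOfEmb_le _ _ W 1 n) (signedLocalPointsOfEmb_le _ _ W (-1) n)) ?_
  intro P hP
  obtain ⟨P₁, hP₁, P₂, hP₂, rfl⟩ := (h W hss.1 ha κ hκ v hv n).1 P hP
  exact AddSubgroup.add_mem _ (AddSubgroup.mem_sup_left hP₁) (AddSubgroup.mem_sup_right hP₂)

/-- Consequently the filed rows determine the signed span index at every layer and every good supersingular type at `2`: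
`1` for `a₂ = 0` (`SignedDecompositionAtTwo`), `2^(Σ_{m ≤ n} ⌊2^m/15⌋)` for `a₂ = ±2` (C5 ∧ C6). -/
theorem spanIndex_of_rows (h0 : SignedDecompositionAtTwo) (h5 : SignedDefectInjectsAtTwo) (h6 : SignedTopDefectAtTwo)
    (W : WeierstrassCurve ℚ) [W.IsElliptic] [W.IsGloballyMinimal] (hss : GoodSS W 2)
    (κ : ZpExtension ℚ 2) (hκ : κ.IsCyclotomic) (v : HeightOneSpectrum (𝓞 ℚ)) (hv : (2 : 𝓞 ℚ) ∈ v.asIdeal) (n : ℕ) :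
    (signedLocalPoints κ (v.adicCompletion ℚ) W 1 n ⊔ signedLocalPoints κ (v.adicCompletion ℚ) W (-1) n).relIndex
        (localLayerPoints κ (v.adicCompletion ℚ) W n) =
      if W.frobeniusTrace 2 = 0 then 1 else 2 ^ ((Finset.range (n + 1)).sum fun m => 2 ^ m / 15) := by
  split_ifs with ha
  · rw [span_eq_layer_of_signedDecomposition h0 W hss ha κ hκ v hv n, AddSubgroup.relIndex_self]
  · exact floorLaw_of_injects_of_topDefect h5 h6 W hss ha κ hκ v hv n

/-- The meet for ALL three types from the two filed halves: `SignedDecompositionAtTwo` (a₂ = 0, second clause) and C3± (a₂ = ±2). -/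
theorem meet_eq_layer_zero_of_rows (h0 : SignedDecompositionAtTwo) (h3 : SignedMeetAtTwoOfTraceNeZero)
    (W : WeierstrassCurve ℚ) [W.IsElliptic] [W.IsGloballyMinimal] (hss : GoodSS W 2)
    (κ : ZpExtension ℚ 2) (hκ : κ.IsCyclotomic) (v : HeightOneSpectrum (𝓞 ℚ)) (hv : (2 : 𝓞 ℚ) ∈ v.asIdeal) (n : ℕ) :
    signedLocalPoints κ (v.adicCompletion ℚ) W 1 n ⊓ signedLocalPoints κ (v.adicCompletion ℚ) W (-1) n =
      localLayerPoints κ (v.adicCompletion ℚ) W 0 := by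
  by_cases ha : W.frobeniusTrace 2 = 0
  · exact (h0 W hss.1 ha κ hκ v hv n).2
  · exact h3 W hss ha κ hκ v hv n

/-- C1′ TRUNCATION: for `n ≤ 3` the floor law asserts the full span `E(ℚ_{2,n}) ≤ E⁺_n ⊔ E⁻_n` for `a₂ = ±2` (index `2^0 = 1`, census `0, 0, 0`). -/
theorem floorLaw_span_of_le_three (h : SignedSpanIndexFloorLawAtTwo) (W : WeierstrassCurve ℚ) [W.IsElliptic] [W.IsGloballyMinimal]
    (hss : GoodSS W 2) (ha : W.frobeniusTrace 2 ≠ 0) (κ : ZpExtension ℚ 2) (hκ : κ.IsCyclotomic)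
    (v : HeightOneSpectrum (𝓞 ℚ)) (hv : (2 : 𝓞 ℚ) ∈ v.asIdeal) (n : ℕ) (hn : n ≤ 3) :
    localLayerPoints κ (v.adicCompletion ℚ) W n ≤
      signedLocalPoints κ (v.adicCompletion ℚ) W 1 n ⊔ signedLocalPoints κ (v.adicCompletion ℚ) W (-1) n := by
  have h1 := h W hss ha κ hκ v hv n
  rw [SignedSubgroupsAtTwo.Kernel.floorExponent_eq_zero_of_le_three n hn, pow_zero] at h1
  exact AddSubgroup.relIndex_eq_one.mp h1

end Summit.BirchSwinnertonDyer.Rank1Residual.F1Sign2.SignedSpanDefect.Kernel
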